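import Mathlib
import Summits.Ventures.PercRepro2.UniversalFlow2
import Summits.Ventures.PercRepro2.UniversalSmall7

/-! # (UH*) on the four eight-edge parallel extensions of the small cases
(seat mine-b, cell pub-perc-repro2; MINE-B.md §23.11)

The 13 series–parallel networks of free edges with 8 edges outside `SP.Good` (enumeration, enum8.py) are the nine
series products of UniversalSmall8A/B/C.lean and four parallel extensions of smaller cases: `e ∗ (B₃ ∧ B₃)` and
`e ∗ e ∗ (B₃ ∧ B₃)`, `(e ∧ e) ∗ (B₃ ∧ B₃)`, `e ∗ (B₃ ∧ B₄)`, `e ∗ (B₃ ∧ (B₂ ∗ P₂))` — these follow from the landed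
instances by `universal_par` (UniversalClosures.lean), which needs nothing of the parts. -/

namespace Summit.Ventures.PercRepro2.V2Closure

open Summit.Ventures.PercRepro2.UHClosure

/-- (UH*) on a two-edge path `e ∧ e` (`universal_ser_edge` with the level Harris inequality of a free edge) -/
theorem SP.universal_path2 : Universal (SP.ser SP.free SP.free).rLab (SP.ser SP.free SP.free).bLab :=
  universal_ser_edge SP.free.rLab SP.free.bLab (SP.graded SP.free).2.1

/-- `e ∗ (B₃ ∧ B₃)` -/
theorem SP.universal_e_b33 : Universal (SP.par SP.free SP.b33).rLab (SP.par SP.free SP.b33).bLab :=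
  universal_par _ _ _ _ SP.universal_free SP.universal_b33

/-- `e ∗ (e ∗ (B₃ ∧ B₃))` -/
theorem SP.universal_ee_b33 :
    Universal (SP.par SP.free (SP.par SP.free SP.b33)).rLab (SP.par SP.free (SP.par SP.free SP.b33)).bLab :=
  universal_par _ _ _ _ SP.universal_free SP.universal_e_b33

/-- `(e ∧ e) ∗ (B₃ ∧ B₃)` -/
theorem SP.universal_p2_b33 :
    Universal (SP.par (SP.ser SP.free SP.free) SP.b33).rLab (SP.par (SP.ser SP.free SP.free) SP.b33).bLab :=
  universal_par _ _ _ _ SP.universal_path2 SP.universal_b33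

/-- `e ∗ (B₃ ∧ B₄)` -/
theorem SP.universal_e_b34 : Universal (SP.par SP.free SP.b34).rLab (SP.par SP.free SP.b34).bLab :=
  universal_par _ _ _ _ SP.universal_free SP.universal_b34

/-- `e ∗ (B₃ ∧ (B₂ ∗ P₂))` -/
theorem SP.universal_e_b3bp : Universal (SP.par SP.free SP.b3bp).rLab (SP.par SP.free SP.b3bp).bLab :=
  universal_par _ _ _ _ SP.universal_free SP.universal_b3bp

end Summit.Ventures.PercRepro2.V2Closure
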